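import Summits.Ventures.GridStability.Lyapunov.StructurePreservingFaceBound
import HarnessLib

/-!
# GridStability/Lyapunov/StructurePreservingFaceCycle — the 1-D DUAL TANGENT CERTIFICATE for a face bound
# along a cycle (Kirchhoff's voltage law + Lagrangian weak duality + the tangent inequality of the convex
# branch energy), in `norm_num`-shaped hypotheses

Cell `gridfusion`, line G2-SCALE (question Q1, level piece); object T2 of the lead's TYPING ORDER (cell STATUS
§10, 2026-08-28) = crux K2′ of idea card «idea-3 / face-local-level-certificates» (HOME/IDEAS-G2.md REV 3, card
sha16 cde2b5ff4cd8b76a) in crit-1's KERNEL FORMAT (STATUS l.10127): «by weak duality ANY rational λ certifies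
min ≥ λ·T + Σ_{e′} min_x [b U(a, x) − λx], and each 1-D convex min is bounded below by its tangent at a rational
x̂_{e′} chosen with rational (cos, sin) via a half-angle tangent, remainder ≤ |f′(x̂) − λ|·π — closed-form
`norm_num` lines, O(|C|) literals per refined face, NO Hessian, NO gradient enclosure over a ball, NO SOS block».
Typed by gridfusion-lit-4 (g14).  0 kit, 0 named facts, no `decide`.

THE MECHANISM (card § Mechanism, Move 2 + crit-1 (s5)).  On the face `δᵢ − δⱼ = +π/2` of the closed window, for
a path `i = u₀, u₁, …, u_k = j` of coupled buses (the cycle is the path plus the branch `{i, j}`), Kirchhoff's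
voltage law reads `Σₗ (δ_{uₗ} − δ_{uₗ₊₁}) = δᵢ − δⱼ = π/2 =: T`, every path branch angle `xₗ = δ_{uₗ} − δ_{uₗ₊₁}`
lies in `[−π/2, π/2]`, and the potential is at least the branch term of `{i, j}` (the constant
`bᵢⱼ·U(aᵢⱼ; π/2)`) plus the path terms `Σₗ bₗ·U(aₗ; xₗ)` (dropped terms `≥ 0`,
`StructurePreservingFaceBound.truncatedPotential_le_potential`).  The minimum of the separable convex sum under
the one linear constraint is bounded by weak duality with any multiplier `λ`, and each one-dimensional term
`bU(a; x) − λx` by its tangent at any `x̂` of the window, with the remainder `|bU′(a; x̂) − λ|·|x − x̂| ≤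
|b(sin x̂ − sin a) − λ|·π` — where THE TANGENT GAP OF THE BRANCH ENERGY IS ITSELF A BRANCH ENERGY:
`U(a; x) − U(a; x̂) − (sin x̂ − sin a)(x − x̂) = branchEnergy x x̂ ≥ 0` on the window (model-2's
`branchEnergy_nonneg`), a `ring` identity.

## Contents (all PROVED; MODELLED column — statements about MODEL MV-3, model-2's `Params`)
* §1 `branchEnergy_sub_tangent` (the identity), `branchEnergy_ge_tangent` (convexity on the window),
  `oneDim_dual_bound` — for `b ≥ 0`, any `λ`, any `x̂` with `|x̂| ≤ π/2` and any `ℓ` with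
  `ℓ ≤ b·U(a; x̂) − λx̂ − |b(sin x̂ − sin a) − λ|·π`: `ℓ ≤ b·U(a; x) − λx` for all `|x| ≤ π/2`.
* §1′ `branchEnergy_halfPi_ge_of_nonneg` / `_of_nonpos` — crit-1's «lemma zero»: rational minorants of the
  closed-form face value `branchEnergy(π/2, a) = cos a − (π/2 − a) sin a` in `(cos a, sin a)` (`sin a ≤ a`, `π` to 6 digits).
* §2 `weak_duality_list` — for a finite family: `Σₖ xₖ = T`, `|xₖ| ≤ π/2`, per-index tangent data as in §1 ⇒
  `λT + Σₖ ℓₖ ≤ Σₖ bₖ·U(aₖ; xₖ)` (list form, the shape an emitter produces from an edge list).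
* §3 `listSum_le_potential` — for a list `L` of ordered coupled pairs with `(L ++ L.map swap).Nodup`
  (`decide`-shaped: no pair repeated in either orientation, no loop), on the closed window
  `Σ_{e ∈ L} b_e·U_e ≤ W` (via `truncatedPotential` of the finset `L ∪ swap L`).
* §4 **`faceBound_of_cycleCert`** — THE FACE CERTIFICATE: data `p` (symmetric `b ≥ 0`), equilibrium branch
  angles within `π/2`, a coupled ordered pair `(i, j)`, a list `L` of path pairs with the KVL identity
  `Σ_{e ∈ L} (δ e.1 − δ e.2) = δ i − δ j` for all `δ` and `((i, j) :: L ++ …swap).Nodup`, a multiplier `λ`,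
  tangent points `x̂` and per-pair bounds `ℓ` satisfying the §1 inequality, and
  `m ≤ bᵢⱼ·branchEnergy(π/2, δ₀ᵢ − δ₀ⱼ) + λ·(π/2) + Σ_{e ∈ L} ℓ e` ⇒ `m ≤ W(δ, δ₀)` for every `δ` of the closed
  window on the face `δᵢ − δⱼ = π/2` — i.e. `m` may be used as the `(i, j)` entry of an `IsFaceBound` family
  (`StructurePreservingFaceRoa.sublevel_subset_regionOfAttraction_of_faceBound`); `isFaceBound_update` replaces
  one entry of a face bound (refining the closed form on the few weak faces, card K1′).
The transcendental numbers `U(a; x̂) = (cos a − cos x̂) − (x̂ − a) sin a` with `a`, `x̂` half-angle / arctan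
expressions are NOT evaluated here: the hypothesis of §1 is the inequality an instance proves with the tree's
enclosures (`StructurePreservingLevelBound.sin_two_mul_arctan`, `…PolytopeLevel.cos_halfAngle_sub`,
Mathlib `Real.pi_gt_d6` / `Real.pi_lt_d6`, `arctan` bounds) — per instance, by the emitter.
THREE COLUMNS: no certificate here; the card's VALIDATED cycle bounds at NETS68 (12.70 / 26.9 / 8.35 / 11.94 vs
`V_min = 7.872`) are the card's; MODELLED: MV-3; no sentence here says a grid is stable.  Sources: weak duality
and the supporting-line inequality are textbook convex analysis [folklore]; the energy function
[cite: Padiyar2013, §3.2 eqs (3.12)–(3.13)]; the face programs [cite: VuTuritsyn2017, §IV-A] (arXiv:1409.1889 §IV).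
-/

noncomputable section

open Set Filter Topology Real
open Summit.Ventures.GridStability.Models.StructurePreserving
open Summit.Ventures.GridStability.Models.StructurePreserving.Params

namespace Summit.Ventures.GridStability.Lyapunov.StructurePreserving

variable {n : ℕ}

/-! ### §1 The tangent inequality of the branch energy and the one-dimensional dual bound -/

/-- **THE TANGENT GAP OF THE BRANCH ENERGY IS A BRANCH ENERGY**:
`U(a; x) − U(a; x̂) − (sin x̂ − sin a)·(x − x̂) = branchEnergy x x̂` (`U(a; x) = branchEnergy x a`,
`∂ₓU(a; x) = sin x − sin a`). [folklore] (polynomial identity in `cos`, `sin`, `x`) -/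
theorem branchEnergy_sub_tangent (x xh a : ℝ) :
    branchEnergy x a - branchEnergy xh a - (Real.sin xh - Real.sin a) * (x - xh) = branchEnergy x xh := by
  unfold branchEnergy
  ring

/-- **CONVEXITY OF THE BRANCH ENERGY ON THE WINDOW, TANGENT FORM**: for `|x̂| ≤ π/2` and `|x| ≤ π/2`,
`U(a; x̂) + (sin x̂ − sin a)(x − x̂) ≤ U(a; x)` (the gap is `branchEnergy x x̂ ≥ 0`, model-2's
`branchEnergy_nonneg`). [cite: Padiyar2013, §3.2 eq (3.13)] -/
theorem branchEnergy_ge_tangent {x xh : ℝ} (a : ℝ) (hxh : |xh| ≤ π / 2) (hx : |x| ≤ π / 2) :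
    branchEnergy xh a + (Real.sin xh - Real.sin a) * (x - xh) ≤ branchEnergy x a := by
  have hgap : 0 ≤ branchEnergy x xh := by
    refine branchEnergy_nonneg hxh ?_
    have h1 := abs_le.mp hx
    have h2 := abs_le.mp hxh
    exact abs_le.mpr ⟨by linarith [h1.1, h2.1], by linarith [h1.2, h2.2]⟩
  have := branchEnergy_sub_tangent x xh a
  linarith

/-- **THE ONE-DIMENSIONAL DUAL BOUND** (crit-1's kernel format): for `b ≥ 0`, any multiplier `λ`, any tangent
point `x̂` with `|x̂| ≤ π/2` and any number `ℓ ≤ b·U(a; x̂) − λx̂ − |b(sin x̂ − sin a) − λ|·π`, every `x` with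
`|x| ≤ π/2` satisfies `ℓ ≤ b·U(a; x) − λx` («each 1-D convex min is bounded below by its tangent at x̂ …
remainder ≤ |f′(x̂) − λ|·π»; `|x − x̂| ≤ π`). [folklore] (supporting line of a convex function) -/
theorem oneDim_dual_bound {b a lam xh ℓ x : ℝ} (hb : 0 ≤ b) (hxh : |xh| ≤ π / 2)
    (hℓ : ℓ ≤ b * branchEnergy xh a - lam * xh - |b * (Real.sin xh - Real.sin a) - lam| * π)
    (hx : |x| ≤ π / 2) : ℓ ≤ b * branchEnergy x a - lam * x := by
  have htan := mul_le_mul_of_nonneg_left (branchEnergy_ge_tangent a hxh hx) hb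
  have hdist : |x - xh| ≤ π := by
    have h1 := abs_le.mp hx
    have h2 := abs_le.mp hxh
    exact abs_le.mpr ⟨by linarith [h1.1, h2.2], by linarith [h1.2, h2.1]⟩
  -- the remainder `(b(sin x̂ − sin a) − λ)(x − x̂) ≥ −|…|·π`
  have hrem : -(|b * (Real.sin xh - Real.sin a) - lam| * π)
      ≤ (b * (Real.sin xh - Real.sin a) - lam) * (x - xh) := by
    have h1 : |(b * (Real.sin xh - Real.sin a) - lam) * (x - xh)|
        ≤ |b * (Real.sin xh - Real.sin a) - lam| * π := by
      rw [abs_mul]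
      exact mul_le_mul_of_nonneg_left hdist (abs_nonneg _)
    have h2 := neg_abs_le ((b * (Real.sin xh - Real.sin a) - lam) * (x - xh))
    linarith
  nlinarith

/-- **LEMMA ZERO (crit-1 (n3)): A RATIONAL MINORANT OF THE CLOSED-FORM FACE VALUE**, equilibrium angle in
`[0, π/2]`.  `branchEnergy(π/2, a) = cos a − (π/2 − a)·sin a`; for `0 ≤ a` one has `sin a ≤ a` (Mathlib
`Real.sin_le`) and `π/2 < 1570797/10⁶` (`Real.pi_lt_d6`), and `sin a ≥ 0` for `a ≤ π`, hence
`cos a − (1570797/10⁶ − sin a)·sin a ≤ branchEnergy(π/2, a)` — rational in `(cos a, sin a)`, which are rational at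
half-angle-tangent equilibria (`StructurePreservingPolytopeLevel.cos_halfAngle_sub`, `sin_halfAngle_sub'`), so the
`2|E|` rows `c < m i j` of an instance are `norm_num` lines over `ℚ`. [folklore] (with [Padiyar2013] §3.2 eq (3.13)) -/
theorem branchEnergy_halfPi_ge_of_nonneg {a : ℝ} (ha : 0 ≤ a) (ha' : a ≤ π / 2) :
    Real.cos a - (1570797 / 1000000 - Real.sin a) * Real.sin a ≤ branchEnergy (π / 2) a := by
  have hpi : π / 2 ≤ 1570797 / 1000000 := by linarith [Real.pi_lt_d6]
  have hsin : Real.sin a ≤ a := Real.sin_le ha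
  have hsin0 : 0 ≤ Real.sin a :=
    Real.sin_nonneg_of_nonneg_of_le_pi ha (by linarith [Real.pi_pos])
  unfold branchEnergy
  rw [Real.cos_pi_div_two]
  nlinarith [mul_le_mul_of_nonneg_right (show π / 2 - a ≤ 1570797 / 1000000 - Real.sin a by linarith) hsin0]

/-- **LEMMA ZERO, nonpositive equilibrium angle**: for `−π/2 ≤ a ≤ 0`, `a ≤ sin a` and `π/2 > 1570796/10⁶`
(`Real.pi_gt_d6`), `sin a ≤ 0`, hence `cos a − (1570796/10⁶ − sin a)·sin a ≤ branchEnergy(π/2, a)`.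
[folklore] (with [Padiyar2013] §3.2 eq (3.13)) -/
theorem branchEnergy_halfPi_ge_of_nonpos {a : ℝ} (ha : a ≤ 0) (ha' : -(π / 2) ≤ a) :
    Real.cos a - (1570796 / 1000000 - Real.sin a) * Real.sin a ≤ branchEnergy (π / 2) a := by
  have hpi : 1570796 / 1000000 ≤ π / 2 := by linarith [Real.pi_gt_d6]
  have hsin : a ≤ Real.sin a := by
    have h := Real.sin_le (neg_nonneg.mpr ha)
    rw [Real.sin_neg] at h
    linarith
  have hsin0 : Real.sin a ≤ 0 :=
    Real.sin_nonpos_of_nonpos_of_neg_pi_le ha (by linarith [Real.pi_pos])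
  unfold branchEnergy
  rw [Real.cos_pi_div_two]
  nlinarith [mul_le_mul_of_nonpos_right (show 1570796 / 1000000 - Real.sin a ≤ π / 2 - a by linarith) hsin0]

/-! ### §2 Lagrangian weak duality along a list of branches -/

/-- **WEAK DUALITY, LIST FORM.**  Branch data as a list of triples-by-functions on an index list: for every
index `k ∈ K` a coupling `b k ≥ 0`, an equilibrium angle `a k`, a tangent point `|xh k| ≤ π/2` and a bound
`ℓ k ≤ b k·U(a k; xh k) − λ·xh k − |b k (sin (xh k) − sin (a k)) − λ|·π`; then for every assignment of branch
angles `x` in the window with the LINEAR CONSTRAINT `Σ_{k ∈ K} x k = T` (Kirchhoff's voltage law on the face):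
`λ·T + Σ_{k ∈ K} ℓ k ≤ Σ_{k ∈ K} b k·U(a k; x k)`  («by weak duality ANY rational λ certifies
min ≥ λ·T + Σ min_x [bU(a, x) − λx]»). [folklore] (Lagrangian relaxation of one equality constraint) -/
theorem weak_duality_list {ι : Type*} (K : List ι) {b a xh ℓ x : ι → ℝ} {lam T : ℝ}
    (hb : ∀ k ∈ K, 0 ≤ b k) (hxh : ∀ k ∈ K, |xh k| ≤ π / 2)
    (hℓ : ∀ k ∈ K, ℓ k ≤ b k * branchEnergy (xh k) (a k) - lam * xh k
      - |b k * (Real.sin (xh k) - Real.sin (a k)) - lam| * π)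
    (hx : ∀ k ∈ K, |x k| ≤ π / 2) (hsum : (K.map x).sum = T) :
    lam * T + (K.map ℓ).sum ≤ (K.map fun k => b k * branchEnergy (x k) (a k)).sum := by
  -- termwise: `ℓ k + λ x k ≤ b U`
  have hterm : ∀ k ∈ K, ℓ k + lam * x k ≤ b k * branchEnergy (x k) (a k) := fun k hk => by
    have := oneDim_dual_bound (hb k hk) (hxh k hk) (hℓ k hk) (hx k hk)
    linarith
  have hle : (K.map fun k => ℓ k + lam * x k).sum ≤ (K.map fun k => b k * branchEnergy (x k) (a k)).sum :=
    List.sum_le_sum hterm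
  have hsplit : (K.map fun k => ℓ k + lam * x k).sum = (K.map ℓ).sum + lam * (K.map x).sum := by
    rw [List.sum_map_add, List.sum_map_mul_left]
  rw [hsplit, hsum] at hle
  linarith

/-! ### §3 A list of distinct branches is below the potential on the closed window -/

/-- The branch term of an ordered pair, `g(e) = b_{e} · U(a_e; δ_{e.1} − δ_{e.2})` (notation for this file).
[cite: Padiyar2013, §3.2 eq (3.13)] -/
def pairTerm (p : Params n) (δ₀ δ : Fin n → ℝ) (e : Fin n × Fin n) : ℝ :=
  p.b e.1 e.2 * branchEnergy (δ e.1 - δ e.2) (δ₀ e.1 - δ₀ e.2)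

/-- The branch term is the same read from either end (symmetric `b`, even `branchEnergy`). [folklore] -/
theorem pairTerm_swap (p : Params n) (hsymm : ∀ i j, p.b i j = p.b j i) (δ₀ δ : Fin n → ℝ)
    (e : Fin n × Fin n) : pairTerm p δ₀ δ e.swap = pairTerm p δ₀ δ e := by
  unfold pairTerm
  simp only [Prod.fst_swap, Prod.snd_swap]
  rw [hsymm e.2 e.1, show δ e.2 - δ e.1 = -(δ e.1 - δ e.2) by ring,
    show δ₀ e.2 - δ₀ e.1 = -(δ₀ e.1 - δ₀ e.2) by ring, branchEnergy_neg_neg]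

/-- `truncatedPotential` over a finset is half the finset sum of `pairTerm`. [folklore] -/
theorem truncatedPotential_eq_sum_pairTerm (p : Params n) (S : Finset (Fin n × Fin n)) (δ₀ δ : Fin n → ℝ) :
    truncatedPotential p S δ₀ δ = (1 / 2) * ∑ e ∈ S, pairTerm p δ₀ δ e := rfl

/-- **A LIST OF DISTINCT BRANCHES IS BELOW THE POTENTIAL ON THE CLOSED WINDOW**: for a list `L` of ordered pairs
such that `L ++ L.map swap` has no duplicates (no pair twice in either orientation, no loop `(i, i)` —
`decide`-shaped for a literal list), symmetric `bᵢⱼ ≥ 0` and equilibrium / current branch angles within `π/2`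
on coupled pairs, `Σ_{e ∈ L} b_e·U_e(δ) ≤ W(δ, δ₀)`: the list sum is the truncated potential of the finset
`(L ++ L.map swap).toFinset`, which is `≤ W` (`truncatedPotential_le_potential`). Card Move 2.
[cite: Padiyar2013, §3.2 eqs (3.12)–(3.13)] -/
theorem listSum_le_potential (p : Params n) (hb : ∀ i j, 0 ≤ p.b i j) (hsymm : ∀ i j, p.b i j = p.b j i)
    {δ₀ δ : Fin n → ℝ} (h0 : ∀ i j, p.b i j ≠ 0 → |δ₀ i - δ₀ j| ≤ π / 2)
    (hP : ∀ i j, p.b i j ≠ 0 → |δ i - δ j| ≤ π / 2) (L : List (Fin n × Fin n))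
    (hnodup : (L ++ L.map Prod.swap).Nodup) :
    (L.map (pairTerm p δ₀ δ)).sum ≤ p.potential δ₀ δ := by
  have key : truncatedPotential p (L ++ L.map Prod.swap).toFinset δ₀ δ = (L.map (pairTerm p δ₀ δ)).sum := by
    rw [truncatedPotential_eq_sum_pairTerm, List.sum_toFinset _ hnodup, List.map_append, List.sum_append,
      List.map_map]
    have hsw : (L.map (pairTerm p δ₀ δ ∘ Prod.swap)).sum = (L.map (pairTerm p δ₀ δ)).sum := by
      congr 1
      refine List.map_congr_left fun e _ => ?_
      exact pairTerm_swap p hsymm δ₀ δ e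
    rw [hsw]
    ring
  rw [← key]
  exact truncatedPotential_le_potential p hb h0 hP _

/-! ### §4 The face certificate along a cycle -/

/-- **THE FACE CERTIFICATE ALONG A CYCLE (1-D dual tangent certificate, crit-1's kernel format).**  DATA:
structure-preserving data `p` with symmetric `bᵢⱼ ≥ 0`; an equilibrium `δ₀` with branch angles within `π/2` on
coupled pairs; a coupled ordered pair `(i, j)`; a list `L` of ordered pairs (the path of the cycle from `i` to
`j` avoiding the branch `{i, j}`) with the KVL identity `Σ_{e ∈ L} (δ e.1 − δ e.2) = δ i − δ j` for every angle
vector (telescoping; for a literal chain `by intro δ; simp; ring`) and `((i, j) :: L ++ ((i, j) :: L).map swap).Nodup`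
(`decide` for a literal list), all path pairs coupled; a multiplier `λ`, tangent points `xh e` with
`|xh e| ≤ π/2` and bounds `ℓ e ≤ b_e·U(a_e; xh e) − λ·xh e − |b_e(sin (xh e) − sin a_e) − λ|·π` for `e ∈ L`
(`a_e = δ₀ e.1 − δ₀ e.2`); and `m ≤ bᵢⱼ·branchEnergy(π/2, δ₀ᵢ − δ₀ⱼ) + λ·(π/2) + Σ_{e ∈ L} ℓ e`.  CONCLUSION: for
every angle vector `δ` of the CLOSED window on the face `δᵢ − δⱼ = π/2`, `m ≤ W(δ, δ₀)` — so `m` is an admissible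
`(i, j)` entry of a face bound (`isFaceBound_update`).  Proof: §3 on the list `(i, j) :: L`, the `(i, j)` term is
the constant `bᵢⱼ·U(π/2)`, and §2 on `L` with `T = π/2`.  Card K2′; «cycle minimum ≥ λ·T + Σ tangent bounds −
remainder». [cite: VuTuritsyn2017, §IV-A] (face programs) with [Padiyar2013] §3.2 eq (3.13) -/
theorem faceBound_of_cycleCert {p : Params n} (hb : ∀ i j, 0 ≤ p.b i j) (hsymm : ∀ i j, p.b i j = p.b j i)
    {δ₀ : Fin n → ℝ} (h0 : ∀ i j, p.b i j ≠ 0 → |δ₀ i - δ₀ j| ≤ π / 2)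
    {i j : Fin n} (L : List (Fin n × Fin n))
    (hkvl : ∀ δ : Fin n → ℝ, (L.map fun e => δ e.1 - δ e.2).sum = δ i - δ j)
    (hnodup : (((i, j) :: L) ++ ((i, j) :: L).map Prod.swap).Nodup)
    (hL : ∀ e ∈ L, p.b e.1 e.2 ≠ 0)
    {lam : ℝ} {xh ℓ : Fin n × Fin n → ℝ} (hxh : ∀ e ∈ L, |xh e| ≤ π / 2)
    (hℓ : ∀ e ∈ L, ℓ e ≤ p.b e.1 e.2 * branchEnergy (xh e) (δ₀ e.1 - δ₀ e.2) - lam * xh e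
      - |p.b e.1 e.2 * (Real.sin (xh e) - Real.sin (δ₀ e.1 - δ₀ e.2)) - lam| * π)
    {m : ℝ} (hm : m ≤ p.b i j * branchEnergy (π / 2) (δ₀ i - δ₀ j) + lam * (π / 2) + (L.map ℓ).sum) :
    ∀ δ : Fin n → ℝ, (∀ k l, p.b k l ≠ 0 → |δ k - δ l| ≤ π / 2) → δ i - δ j = π / 2 →
      m ≤ p.potential δ₀ δ := by
  intro δ hδ hface
  -- the list `(i, j) :: L` is below the potential
  have hsum := listSum_le_potential p hb hsymm h0 hδ ((i, j) :: L) hnodup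
  rw [List.map_cons, List.sum_cons] at hsum
  -- the `(i, j)` term is the constant closed form
  have hij_term : pairTerm p δ₀ δ (i, j) = p.b i j * branchEnergy (π / 2) (δ₀ i - δ₀ j) := by
    simp only [pairTerm, hface]
  -- weak duality on the path with `T = π/2`
  have hT : (L.map fun e => δ e.1 - δ e.2).sum = π / 2 := by rw [hkvl δ, hface]
  have hwd := weak_duality_list L (b := fun e => p.b e.1 e.2) (a := fun e => δ₀ e.1 - δ₀ e.2)
    (xh := xh) (ℓ := ℓ) (x := fun e => δ e.1 - δ e.2) (lam := lam) (T := π / 2)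
    (fun e he => hb e.1 e.2) hxh hℓ (fun e he => hδ e.1 e.2 (hL e he)) hT
  have hpath : (L.map fun e => p.b e.1 e.2 * branchEnergy (δ e.1 - δ e.2) (δ₀ e.1 - δ₀ e.2)).sum
      = (L.map (pairTerm p δ₀ δ)).sum := rfl
  rw [hpath] at hwd
  rw [hij_term] at hsum
  linarith

/-- **UPDATING ONE ENTRY OF A FACE BOUND** (card K1′ «few-and-short»: closed forms on all faces, refined on the
`k` weak ones): if `m` is a face bound and `m'` bounds `W` on the face of the coupled ordered pair `(i, j)`, then
the family equal to `m'` at `(i, j)` and to `m` elsewhere is a face bound. [folklore] -/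
theorem isFaceBound_update {p : Params n} {δ₀ : Fin n → ℝ} {m : Fin n → Fin n → ℝ} (hm : IsFaceBound p δ₀ m)
    {i j : Fin n} {m' : ℝ}
    (hm' : ∀ δ : Fin n → ℝ, (∀ k l, p.b k l ≠ 0 → |δ k - δ l| ≤ π / 2) → δ i - δ j = π / 2 →
      m' ≤ p.potential δ₀ δ) :
    IsFaceBound p δ₀ (fun k l => if k = i ∧ l = j then m' else m k l) := by
  intro k l hkl δ hδ hface
  show (if k = i ∧ l = j then m' else m k l) ≤ p.potential δ₀ δ
  by_cases h : k = i ∧ l = j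
  · obtain ⟨rfl, rfl⟩ := h
    rw [if_pos ⟨rfl, rfl⟩]
    exact hm' δ hδ hface
  · rw [if_neg h]
    exact hm k l hkl δ hδ hface

end Summit.Ventures.GridStability.Lyapunov.StructurePreserving

end
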